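import Summits.Ventures.PercRepro.C026PFunHalfEM

/-!
# `(P) ≥ 0` on every skeleton whose probe lies on the zero piece (p6, gen 17)

If the probe's cell satisfies `x_c ≤ ½`, CONJECTURE (P) holds on EVERY skeleton, at every band
state of the other vertices: at the probe's lower corner `K_c = 0` the `K`-term of every summand
vanishes (`K_c(ω) = ∏_{v ∈ Γ(ω)} K v` contains the factor `K c = 0`), and the linear term is
`N_c(ω)·(1 − 2X_c(ω)) ≥ 0` because `X_c(ω) = x_c·∏_{v ∈ Γ(ω) ∖ c} x_v ≤ x_c ≤ ½`
(`pFun_nonneg_of_probe_zero`); K-monotonicity (`pFun_mono_K`) lifts this to every `K_c ≥ 0`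
(`pFun_nonneg_of_probe_half`).  So the content of CONJECTURE (P) is the probe on the tight curve
`x_c > ½` — the bare probe `x_c = 1` being mine-3's binding case (§35).
-/

namespace PercRepro

namespace MultiGraph

open Finset

variable {V E : Type*} [Fintype V] [DecidableEq V] [Fintype E] [DecidableEq E]
  {G : MultiGraph V E}

omit [Fintype E] [DecidableEq E] in
/-- `X_c(ω) ≤ x_c` for cells in `[0, 1]`: the probe's own cell is one of the factors. -/
theorem xCluster_le_self {x : V → ℝ} (hx : ∀ v, 0 ≤ x v ∧ x v ≤ 1) (c : V) (ω : Config E) :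
    G.xCluster x c ω ≤ x c := by
  unfold xCluster
  rw [← Finset.mul_prod_erase _ _ (self_mem_clusterF ω c)]
  have h1 : ∏ v ∈ (G.clusterF ω c).erase c, x v ≤ 1 :=
    Finset.prod_le_one (fun v _ => (hx v).1) (fun v _ => (hx v).2)
  have h0 : 0 ≤ ∏ v ∈ (G.clusterF ω c).erase c, x v := Finset.prod_nonneg fun v _ => (hx v).1
  nlinarith [(hx c).1]

omit [DecidableEq V] [Fintype E] [DecidableEq E] in
/-- `K_c(ω) = 0` when the probe's `K`-cell vanishes. -/
theorem kCluster_eq_zero_of_probe {K : V → ℝ} (c : V) (hK : K c = 0) (ω : Config E) :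
    G.kCluster K c ω = 0 :=
  Finset.prod_eq_zero (self_mem_clusterF ω c) hK

/-- **`(P) ≥ 0` at a zero-piece probe corner**: `x_c ≤ ½` and `K_c = 0` (the other cells in
`[0, 1]`, any `K`), on every skeleton and every edge set. -/
theorem pFun_nonneg_of_probe_zero {c : V} {x K : V → ℝ} (hx : ∀ v, 0 ≤ x v ∧ x v ≤ 1)
    (hxc : x c ≤ 1 / 2) (hKc : K c = 0) (F : Finset E) : 0 ≤ G.pFun c x K F := by
  unfold pFun
  refine Finset.sum_nonneg fun ω _ => ?_
  rw [kCluster_eq_zero_of_probe c hKc, zero_mul, add_zero]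
  refine mul_nonneg (nbarOff_nonneg hx c ω) ?_
  have := xCluster_le_self (G := G) hx c ω
  linarith

/-- **CONJECTURE (P) holds whenever the probe lies on the zero piece** `x_c ≤ ½`: for every
skeleton, every edge set and every band state of the other vertices (`K_c ≥ 0` arbitrary). -/
theorem pFun_nonneg_of_probe_half {c : V} {x K : V → ℝ} (hx : ∀ v, 0 ≤ x v ∧ x v ≤ 1)
    (hK : ∀ v, 0 ≤ K v) (hxc : x c ≤ 1 / 2) (F : Finset E) : 0 ≤ G.pFun c x K F := by
  have h0 : 0 ≤ G.pFun c x (Function.update K c 0) F :=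
    pFun_nonneg_of_probe_zero hx hxc (Function.update_self c 0 K) F
  refine h0.trans (pFun_mono_K hx (fun v => ?_) (fun v => ?_) F)
  · by_cases hv : v = c
    · subst hv
      simp
    · rw [Function.update_of_ne hv]
      exact hK v
  · by_cases hv : v = c
    · subst hv
      simp [hK v]
    · rw [Function.update_of_ne hv]

end MultiGraph

end PercRepro
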